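import Summits.QuantumFields.GaugeBoot.ClassBNegativeCouplingEmpty
import Summits.QuantumFields.GaugeBoot.TiltedBoxLimitClassBTwoDim
import HarnessLib

/-!
# In two dimensions Class B is inhabited EXACTLY for `β ≥ 0` (gauge-boot, task L3(α))

HONEST FRAMING (cell `pub-gaugeboot`, page 1 of every file): the venture produces certified bounds
on lattice expectations at stated coupling, gauge group, dimension and torus size; NOT a mass gap,
NOT a continuum limit, NOT a string tension; NOT Yang–Mills-summit-bearing (barriers
`FixedCouplingUltralocality`, `PerturbativeInvisibility`). Structural statement about the Class-B
column (SCOPING A18); certifies no number.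

## Content

Two dimensions (`i ≠ j` and every axis is `i` or `j`), `G` compact metrisable, `ρ` continuous
(`N ≥ 1`) with a central scalar `ρ z = ω • 1`, `ω ≠ 1`:

* ★★★ **`nonempty_classBState_two_iff`** — `Nonempty (ClassBState d ρ β) ↔ 0 ≤ β`:
  for `β ≥ 0` the tilted boxes supply a Class-B state (`TiltedRP.nonempty_classBState_of_two`,
  `TiltedBoxLimitClassBTwoDim.lean`); for `β < 0` Class B is empty in every dimension
  (`isEmpty_classBState_of_neg`, `ClassBNegativeCouplingEmpty.lean`).
* `nonempty_classBState_fin_two_iff_suN` / `_uN` — the matrix groups `SU(N)` (`N ≥ 2`), `U(N)`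
  (`N ≥ 1`) on `ℤ²` literally (`d = 2`).

So the complete answer to "for which couplings do Kazakov–Zheng's infinite-volume axioms with the
diagonal reflection family have a model in two-dimensional lattice gauge theory" is: the closed
half-line `β ≥ 0`. (In `d ≥ 3` inhabitation at `β ≥ 0` outside the uniqueness windows is open.)
-/

open MeasureTheory

namespace Summit.QuantumFields.GaugeBoot

open Literature.MathematicalPhysics.QuantumLattice

noncomputable section

variable {d N : ℕ} {G : Type*} [Group G] [TopologicalSpace G] [IsTopologicalGroup G]
  [CompactSpace G] [MeasurableSpace G] [BorelSpace G] [T2Space G] [SecondCountableTopology G]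
  (ρ : G →* Matrix (Fin N) (Fin N) ℂ)

omit [Group G] [TopologicalSpace G] [IsTopologicalGroup G] [CompactSpace G] [MeasurableSpace G]
  [BorelSpace G] [T2Space G] [SecondCountableTopology G] in
/-- Two distinct axes force `2 ≤ d`. -/
theorem two_le_of_ne {i j : Fin d} (hij : i ≠ j) : 2 ≤ d := by
  by_contra h
  have : Subsingleton (Fin d) := Fin.subsingleton_iff_le_one.2 (by omega)
  exact hij (Subsingleton.elim i j)

/-- ★★★ **In two dimensions Class B is inhabited iff `β ≥ 0`.** `i ≠ j` the two axes
(`∀ k, k = i ∨ k = j`), `G` compact metrisable, `ρ` continuous (`N ≥ 1`) with `ρ z = ω • 1`, `ω ≠ 1`: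
`Nonempty (ClassBState d ρ β) ↔ 0 ≤ β`. -/
theorem nonempty_classBState_two_iff [NeZero N] {i j : Fin d} (hij : i ≠ j)
    (hd : ∀ k : Fin d, k = i ∨ k = j) (hρ : Continuous ρ) {z : G} {ω : ℂ}
    (hz : ρ z = ω • (1 : Matrix (Fin N) (Fin N) ℂ)) (hω : ω ≠ 1) (β : ℝ) :
    Nonempty (ClassBState d ρ β) ↔ 0 ≤ β := by
  constructor
  · intro ⟨w⟩
    by_contra hβ
    exact ClassBState.false_of_neg ρ hρ hz hω (two_le_of_ne hij) (not_le.1 hβ) w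
  · exact fun hβ => TiltedRP.nonempty_classBState_of_two ρ hij hd hρ hβ

open Literature.MathematicalPhysics.QuantumFieldTheory in
/-- ★★★ **`SU(N)` on `ℤ²` (`N ≥ 2`): Class B is inhabited iff `β ≥ 0`.** -/
theorem nonempty_classBState_fin_two_iff_suN {N : ℕ} (hN : 2 ≤ N) (β : ℝ) :
    Nonempty (ClassBState 2 (fundamentalRep (Fin N)) β) ↔ 0 ≤ β := by
  haveI : NeZero N := ⟨by omega⟩
  haveI : SecondCountableTopology (Matrix (Fin N) (Fin N) ℂ) :=
    inferInstanceAs (SecondCountableTopology (Fin N → Fin N → ℂ))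
  haveI : SecondCountableTopology (Matrix.specialUnitaryGroup (Fin N) ℂ) :=
    Topology.IsEmbedding.subtypeVal.secondCountableTopology
  obtain ⟨z, ζ, hζ1, hz, -⟩ := IsSpecialUnitaryModel.exists_central (fundamentalRep (Fin N))
    (TorusAreaLaw.isSpecialUnitaryModel_fundamentalRep N) hN
  exact nonempty_classBState_two_iff (fundamentalRep (Fin N)) Fin.zero_ne_one
    (fun k => by fin_cases k <;> simp) (continuous_fundamentalRep (Fin N)) hz hζ1 β

open Literature.MathematicalPhysics.QuantumFieldTheory in
/-- ★★★ **`U(N)` on `ℤ²` (`N ≥ 1`; `N = 1`: compact `U(1)`): Class B is inhabited iff `β ≥ 0`.** -/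
theorem nonempty_classBState_fin_two_iff_uN {N : ℕ} (hN : 1 ≤ N) (β : ℝ) :
    Nonempty (ClassBState 2 (unitaryFundamentalRep (Fin N) ℂ) β) ↔ 0 ≤ β := by
  haveI : NeZero N := ⟨by omega⟩
  haveI : SecondCountableTopology (Matrix.unitaryGroup (Fin N) ℂ) :=
    IsUnitaryModel.secondCountableTopology _ (isUnitaryModel_unitaryFundamentalRep N)
  obtain ⟨z, hz, -⟩ := IsUnitaryModel.exists_central (unitaryFundamentalRep (Fin N) ℂ)
    (isUnitaryModel_unitaryFundamentalRep N)
  have hz' : unitaryFundamentalRep (Fin N) ℂ z = (-1 : ℂ) • (1 : Matrix (Fin N) (Fin N) ℂ) := by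
    rw [hz, neg_one_smul]
  exact nonempty_classBState_two_iff (unitaryFundamentalRep (Fin N) ℂ) Fin.zero_ne_one
    (fun k => by fin_cases k <;> simp) (continuous_unitaryFundamentalRep (Fin N) ℂ) hz'
    (by norm_num) β

end

end Summit.QuantumFields.GaugeBoot
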